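import Summits.BirchSwinnertonDyer.BirchSwinnertonDyer.Theorems.ManinLocalTwoThreePinningFourHundredTablesD
import HarnessLib

/-!
# Level 400 by the PINNING KERNEL — table certificates (part 5 of 11)

Cell `bsd-f2-manin`, route `ManinLocalTwoThree`, crux C2 `ManinOddAtFour` (stmt-BirchSwinnertonDyer-22967), an g57 (pipeline of an g56);
`--supports stmt-BirchSwinnertonDyer-22967` (helper).  The convolution certificates `tabsᵢ · DEN(rᵢ) = NUM(rᵢ, aᵢ)` (depth 192,
SPARSE certificates of an g55 `…EtaCertificateSparse` (trivial products skipped, pentagonal Euler tables of p3 `…EtaCertificateFast`), one `decide +kernel` each) of forms `32 … 37` of `…PinningFourHundredTables`.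
HONEST FRAMING: kernel-checked identities of integer lists only. [cite: Koehler2011, §2.1]
-/

set_option autoImplicit false
-- lint-debt: the directory name repeats the summit name (sibling precedent `ManinLocalTwoThreePinningSixtyThree.lean`)
set_option linter.dupNamespace false

noncomputable section


open Complex
open UpperHalfPlane hiding I
open scoped MatrixGroups ModularForm
open ModularForm CongruenceSubgroup
open Literature.NumberTheory.ModularForms
open Literature.NumberTheory.EllipticCurves Literature.NumberTheory.EllipticCurves.ModularForms

namespace Summit.BirchSwinnertonDyer.BirchSwinnertonDyer.Theorems.ManinLocalTwoThree.PinningFourHundred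

open Summit.BirchSwinnertonDyer.BirchSwinnertonDyer.Theorems.ManinLocalTwoThree.BracketSturm
open Summit.BirchSwinnertonDyer.BirchSwinnertonDyer.Theorems.ManinLocalTwoThree.PinningKernel


set_option maxHeartbeats 4000000
set_option maxRecDepth 16384

/-! ## §2e Table certificates (forms `32 … 37`) -/

/-- Table certificate of the basis quotient `32` (kernel `decide`). [folklore] -/
theorem hcert32 : mulList 192 (tabs 32) (etaDenListSparse 192 400 (expFn (Ls[32]).1)) = etaNumListSparse 192 400 (expFn (Ls[32]).1) (shifts 32) := by decide +kernel
/-- Table certificate of the basis quotient `33` (kernel `decide`). [folklore] -/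
theorem hcert33 : mulList 192 (tabs 33) (etaDenListSparse 192 400 (expFn (Ls[33]).1)) = etaNumListSparse 192 400 (expFn (Ls[33]).1) (shifts 33) := by decide +kernel
/-- Table certificate of the basis quotient `34` (kernel `decide`). [folklore] -/
theorem hcert34 : mulList 192 (tabs 34) (etaDenListSparse 192 400 (expFn (Ls[34]).1)) = etaNumListSparse 192 400 (expFn (Ls[34]).1) (shifts 34) := by decide +kernel
/-- Table certificate of the basis quotient `35` (kernel `decide`). [folklore] -/
theorem hcert35 : mulList 192 (tabs 35) (etaDenListSparse 192 400 (expFn (Ls[35]).1)) = etaNumListSparse 192 400 (expFn (Ls[35]).1) (shifts 35) := by decide +kernel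
/-- Table certificate of the basis quotient `36` (kernel `decide`). [folklore] -/
theorem hcert36 : mulList 192 (tabs 36) (etaDenListSparse 192 400 (expFn (Ls[36]).1)) = etaNumListSparse 192 400 (expFn (Ls[36]).1) (shifts 36) := by decide +kernel
/-- Table certificate of the basis quotient `37` (kernel `decide`). [folklore] -/
theorem hcert37 : mulList 192 (tabs 37) (etaDenListSparse 192 400 (expFn (Ls[37]).1)) = etaNumListSparse 192 400 (expFn (Ls[37]).1) (shifts 37) := by decide +kernel

end Summit.BirchSwinnertonDyer.BirchSwinnertonDyer.Theorems.ManinLocalTwoThree.PinningFourHundred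

end
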